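/-
Copyright (c) 2026 the pub-hodgecm-mathlib formalisation cell (harness21).  Prover seat hodgecm-mathlib-K2E3-p14 (g7), Track B «K2-LIT» ∕ h413
(`stmt-HodgeConjecture-24833`), line `K2_E3_EllipticInputs`, leaf (nsc-S-A′), brick (E4b) = discharge of `h3cell` of ★ E4a, shared tools (E4b-τ), file 2.  2026-09-04.
-/
import Mathlib.MeasureTheory.Measure.Haar.Basic
import Mathlib.MeasureTheory.Integral.Bochner.Set
import Mathlib.MeasureTheory.Group.Measure
import HarnessLib

/-!
# K2_E3 road (h413), leaf (nsc-S-A′), brick (E4b-τ) file 2 — the push-forward of a Haar probability along a homomorphism onto a compact open subgroup,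
# packaged as an integration formula on cosets

Cell `pub/hodgecm-mathlib` (D-0151), Track B, seat K2E3-p14 (g7) (dealer D108); consumers (E4b-1β) K2E3-p21 (g7) and (E4b-1γ) K2E3-p25 (g2) («(τ3) the push-forward of
the Haar probability of the compact group `S = U_P(𝔭^{-N})` under `ℓ_p : S ↠ L_p ≤ F`, the `(1,2)`-coordinate of `p u p⁻¹`»).  `--supports stmt-HodgeConjecture-24833 --as
helper`; THEOREMS ONLY; GENERIC (Mathlib-level); COUNT-NEUTRAL.

THE MATHEMATICS ([BernsteinZelevinsky1977, Thm. 5.2, the `U_P`-integration on a cell]; [DeitmarEchterhoff2014, Thm. 1.3.4] uniqueness of Haar measure).  `S` a compact group with a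
left-invariant probability measure `μ_S`; `A` a second countable locally compact abelian group with a Haar measure `μ_A`; `ℓ : S → A` continuous with
`ℓ(st) = ℓ(s) + ℓ(t)` and OPEN image `L` (a compact open subgroup).  Then `ℓ_* μ_S` is an `L`-invariant probability measure carried by `L`, hence (uniqueness of
Haar measure on the compact group `L`, Mathlib `addHaarMeasure_unique`) equals `μ_A(L)⁻¹ · μ_A|_L` (**`map_eq_inv_smul_restrict_of_isOpen_range`**), and consequently
**`integral_comp_add_eq_inv_smul_setIntegral_vadd`**: `∫_S h(y₀ + ℓ(s)) dμ_S(s) = μ_A(L)⁻¹ ∫_{y₀ + L} h dμ_A` for every strongly measurable `h` and every `y₀ ∈ A`.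
Combined with ★ (E4b-τ) file 1 `setIntegral_leftAddCoset_eq_zero_of_support_subset` this evaluates the `S`-average of a cell function as a coset integral.
HONEST LABEL: HC_CM is proved only modulo the 7 printed citations (2 remaining named inputs: hLiu418 = stmt-HodgeConjecture-24832, h413 = stmt-HodgeConjecture-24833)
until rung 0 closes; count-neutral helper.

## Mathlib ∕ tree search
`MeasureTheory.Measure.addHaarMeasure_unique`, `PositiveCompacts` (`⊤` on a compact space), `Measure.comap`∕`comap_subtype_coe_apply`∕`map_comap_subtype_coe`,
`MeasurableSet.subtype_image`, `Measure.map_apply`, `measure_preimage_mul`∕`measure_preimage_add`, `Measure.restrict_eq_self_of_ae_mem`, `integral_map`,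
`integral_smul_measure`, `MeasurePreserving.setIntegral_image_emb`, `measurePreserving_add_left`, `MeasurableEquiv.addLeft`.
Dedup: `rg "inv_smul_restrict_of_isOpen_range|inv_smul_setIntegral_vadd"` — no hits.

## References
* [BernsteinZelevinsky1977] I. N. Bernstein, A. V. Zelevinsky, *Induced representations of reductive p-adic groups I*, Ann. Sci. ÉNS 10 (1977), Thm. 5.2.
* [DeitmarEchterhoff2014] A. Deitmar, S. Echterhoff, *Principles of Harmonic Analysis*, 2nd ed. (Springer, 2014), Thm. 1.3.4 (uniqueness of Haar measure).
-/

set_option autoImplicit false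
set_option linter.dupNamespace false

noncomputable section

open Function MeasureTheory MeasureTheory.Measure TopologicalSpace
open scoped Pointwise ENNReal

namespace Summit.HodgeConjecture.HodgeConjecture.Cruxes.H413.K2E3HaarPushforwardCoset

variable {S : Type*} [Group S] [TopologicalSpace S] [IsTopologicalGroup S] [MeasurableSpace S] [BorelSpace S]
  {A : Type*} [AddCommGroup A] [TopologicalSpace A] [IsTopologicalAddGroup A] [SecondCountableTopology A]
  [MeasurableSpace A] [BorelSpace A]

omit [TopologicalSpace S] [IsTopologicalGroup S] [MeasurableSpace S] [BorelSpace S] [TopologicalSpace A] [IsTopologicalAddGroup A]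
  [SecondCountableTopology A] [MeasurableSpace A] [BorelSpace A] in
/-- The range of a continuous map `ℓ : S → A` from a compact group with `ℓ(st) = ℓ s + ℓ t` is a compact additive subgroup; here: it contains `0`, is closed under `+`
and `-`. [folklore] -/
theorem range_addSubgroup_props (ℓ : S → A) (hℓ : ∀ s t, ℓ (s * t) = ℓ s + ℓ t) :
    ℓ 1 = 0 ∧ (∀ s, ℓ s⁻¹ = -ℓ s) ∧ ∀ x ∈ Set.range ℓ, ∀ y ∈ Set.range ℓ, x + y ∈ Set.range ℓ := by
  have h1 : ℓ 1 = 0 := by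
    have := hℓ 1 1
    rw [mul_one] at this
    exact left_eq_add.1 this
  refine ⟨h1, fun s => ?_, ?_⟩
  · have := hℓ s s⁻¹
    rw [mul_inv_cancel, h1] at this
    exact (neg_eq_of_add_eq_zero_right this.symm).symm
  · rintro x ⟨s, rfl⟩ y ⟨t, rfl⟩
    exact ⟨s * t, hℓ s t⟩

/-- **(τ3) THE PUSH-FORWARD OF A LEFT-INVARIANT PROBABILITY ALONG A HOMOMORPHISM ONTO A COMPACT OPEN SUBGROUP IS THE NORMALISED HAAR RESTRICTION**:
`ℓ_* μ_S = μ_A(L)⁻¹ · μ_A|_L`, `L = range ℓ` open.  (Both sides, pulled back to the compact group `L`, are `L`-invariant probability measures; Mathlib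
`addHaarMeasure_unique`.) [cite: DeitmarEchterhoff2014, Thm. 1.3.4] [cite: BernsteinZelevinsky1977, Thm. 5.2] -/
theorem map_eq_inv_smul_restrict_of_isOpen_range [CompactSpace S] (μS : Measure S) [μS.IsMulLeftInvariant] [IsProbabilityMeasure μS]
    (μA : Measure A) [μA.IsAddHaarMeasure] (ℓ : S → A) (hℓc : Continuous ℓ) (hℓ : ∀ s t, ℓ (s * t) = ℓ s + ℓ t) (hL : IsOpen (Set.range ℓ)) :
    μS.map ℓ = (μA (Set.range ℓ))⁻¹ • μA.restrict (Set.range ℓ) := by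
  obtain ⟨h1, hinv, hadd⟩ := range_addSubgroup_props ℓ hℓ
  -- the compact open subgroup `L = range ℓ`
  let L : AddSubgroup A :=
    { carrier := Set.range ℓ
      zero_mem' := ⟨1, h1⟩
      add_mem' := fun hx hy => hadd _ hx _ hy
      neg_mem' := by
        rintro _ ⟨s, rfl⟩
        exact ⟨s⁻¹, hinv s⟩ }
  have hLcoe : (L : Set A) = Set.range ℓ := rfl
  have hLc : IsCompact (L : Set A) := isCompact_range hℓc
  have hLm : MeasurableSet (L : Set A) := hL.measurableSet
  haveI : CompactSpace L := isCompact_iff_compactSpace.1 hLc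
  have hLpos : μA (L : Set A) ≠ 0 := (hL.measure_pos μA ⟨0, ⟨1, h1⟩⟩).ne'
  have hLtop : μA (L : Set A) ≠ ∞ := hLc.measure_lt_top.ne
  haveI : SecondCountableTopology L := TopologicalSpace.Subtype.secondCountableTopology (L : Set A)
  -- the two measures on the group `L`: `ν' = (ℓ_* μ_S)|^L` and `ρ' = μ_A|^L`
  set ν : Measure A := μS.map ℓ with hνdef
  have hν : ∀ B : Set A, MeasurableSet B → ν B = μS (ℓ ⁻¹' B) := fun B hB => by rw [hνdef, Measure.map_apply hℓc.measurable hB]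
  set ν' : Measure L := ν.comap ((↑) : L → A) with hν'def
  set ρ' : Measure L := μA.comap ((↑) : L → A) with hρ'def
  have hemb : MeasurableEmbedding ((↑) : L → A) := MeasurableEmbedding.subtype_coe hLm
  have hrange : Set.range ((↑) : L → A) = (L : Set A) := by
    ext x
    exact ⟨fun ⟨y, hy⟩ => hy ▸ y.2, fun hx => ⟨⟨x, hx⟩, rfl⟩⟩
  have himage : ∀ B : Set L, MeasurableSet B → MeasurableSet (((↑) : L → A) '' B) := fun B hB => hemb.measurableSet_image' hB
  have hν' : ∀ B : Set L, MeasurableSet B → ν' B = μS (ℓ ⁻¹' (((↑) : L → A) '' B)) := fun B hB => by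
    rw [hν'def, hemb.comap_apply, hν _ (himage B hB)]
  have hρ' : ∀ B : Set L, ρ' B = μA (((↑) : L → A) '' B) := fun B => by rw [hρ'def, hemb.comap_apply]
  -- translation of images: `val '' ((a + ·) ⁻¹' B) = (↑a + ·) ⁻¹' (val '' B)`
  have hpre : ∀ (a : L) (B : Set L), ((↑) : L → A) '' ((fun x : L => a + x) ⁻¹' B) = (fun y : A => (a : A) + y) ⁻¹' (((↑) : L → A) '' B) := by
    intro a B
    ext y
    simp only [Set.mem_image, Set.mem_preimage]
    constructor
    · rintro ⟨x, hx, rfl⟩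
      exact ⟨a + x, hx, rfl⟩
    · rintro ⟨z, hz, hzy⟩
      refine ⟨-a + z, by rwa [add_neg_cancel_left], ?_⟩
      rw [AddSubgroup.coe_add, AddSubgroup.coe_neg, hzy, neg_add_cancel_left]
  -- `ν'` is `L`-invariant
  haveI : ν'.IsAddLeftInvariant := by
    refine ⟨fun a => Measure.ext fun B hB => ?_⟩
    rw [Measure.map_apply (measurable_const_add a) hB, hν' _ (measurable_const_add a hB), hν' _ hB, hpre]
    obtain ⟨s₀, hs₀⟩ : (a : A) ∈ Set.range ℓ := a.2
    have : ℓ ⁻¹' ((fun y : A => (a : A) + y) ⁻¹' (((↑) : L → A) '' B)) = (fun s => s₀ * s) ⁻¹' (ℓ ⁻¹' (((↑) : L → A) '' B)) := by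
      ext s
      simp only [Set.mem_preimage, hℓ, hs₀]
    rw [this, measure_preimage_mul]
  -- `ρ'` is `L`-invariant
  haveI : ρ'.IsAddLeftInvariant := by
    refine ⟨fun a => Measure.ext fun B hB => ?_⟩
    rw [Measure.map_apply (measurable_const_add a) hB, hρ', hρ', hpre, measure_preimage_add]
  -- both are finite, `ν'` is a probability measure
  have hν'univ : ν' Set.univ = 1 := by
    rw [hν' _ MeasurableSet.univ, Set.image_univ, hrange]
    have : ℓ ⁻¹' (L : Set A) = Set.univ := Set.eq_univ_of_forall fun s => (⟨s, rfl⟩ : ℓ s ∈ Set.range ℓ)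
    rw [this, measure_univ]
  have hρ'univ : ρ' Set.univ = μA (L : Set A) := by rw [hρ', Set.image_univ, hrange]
  haveI : IsFiniteMeasure ν' := ⟨by rw [hν'univ]; exact ENNReal.one_lt_top⟩
  haveI : IsFiniteMeasure ρ' := ⟨by rw [hρ'univ]; exact hLc.measure_lt_top⟩
  -- uniqueness of Haar measure on the compact group `L`
  haveI : Nonempty L := ⟨0⟩
  have huν := addHaarMeasure_unique ν' (⊤ : PositiveCompacts L)
  have huρ := addHaarMeasure_unique ρ' (⊤ : PositiveCompacts L)
  rw [PositiveCompacts.coe_top, hν'univ, one_smul] at huν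
  rw [PositiveCompacts.coe_top, hρ'univ] at huρ
  have hν'ρ' : ν' = (μA (L : Set A))⁻¹ • ρ' := by
    rw [huρ, smul_smul, ENNReal.inv_mul_cancel hLpos hLtop, one_smul, huν]
  -- push forward along the inclusion `L ↪ A`
  have hνL : ν.restrict (L : Set A) = ν := by
    refine Measure.restrict_eq_self_of_ae_mem (mem_ae_iff.2 ?_)
    show ν (L : Set A)ᶜ = 0
    rw [hν _ hLm.compl]
    have : ℓ ⁻¹' (L : Set A)ᶜ = ∅ := Set.eq_empty_of_forall_notMem fun s hs => hs ⟨s, rfl⟩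
    rw [this, measure_empty]
  have hmap : ν'.map ((↑) : L → A) = ν := by rw [hν'def, hemb.map_comap, hrange, hνL]
  rw [← hmap, hν'ρ', Measure.map_smul, hρ'def, hemb.map_comap, hrange]
  rfl

/-- **(τ3′) INTEGRATION ALONG THE PUSH-FORWARD, ON COSETS**: with `S, μ_S, A, μ_A, ℓ` as above (`L = range ℓ` open) and `h` strongly measurable,
`∫_S h(y₀ + ℓ(s)) dμ_S(s) = μ_A(L)⁻¹ · ∫_{y₀ + L} h dμ_A` for every `y₀ ∈ A`.  (The `S`-average of a function of the coordinate `ℓ` is the normalised coset integral; with ★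
`setIntegral_leftAddCoset_eq_zero_of_support_subset` it vanishes when `∫ h = 0` and `supp h` fits in a coset of `L`.) [cite: BernsteinZelevinsky1977, Thm. 5.2] [cite: DeitmarEchterhoff2014, Thm. 1.3.4] -/
theorem integral_comp_add_eq_inv_smul_setIntegral_vadd [CompactSpace S] (μS : Measure S) [μS.IsMulLeftInvariant] [IsProbabilityMeasure μS]
    (μA : Measure A) [μA.IsAddHaarMeasure] (ℓ : S → A) (hℓc : Continuous ℓ) (hℓ : ∀ s t, ℓ (s * t) = ℓ s + ℓ t) (hL : IsOpen (Set.range ℓ))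
    {E : Type*} [NormedAddCommGroup E] [NormedSpace ℝ E] [CompleteSpace E] {h : A → E} (hh : StronglyMeasurable h) (y₀ : A) :
    ∫ s, h (y₀ + ℓ s) ∂μS = (μA.real (Set.range ℓ))⁻¹ • ∫ x in y₀ +ᵥ Set.range ℓ, h x ∂μA := by
  have hmeas : StronglyMeasurable fun x : A => h (y₀ + x) := hh.comp_measurable (measurable_const_add y₀)
  have h1 : ∫ s, h (y₀ + ℓ s) ∂μS = ∫ x, h (y₀ + x) ∂(μS.map ℓ) := (integral_map_of_stronglyMeasurable hℓc.measurable hmeas).symm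
  have h2 : ∫ x in Set.range ℓ, h (y₀ + x) ∂μA = ∫ x in y₀ +ᵥ Set.range ℓ, h x ∂μA := by
    rw [← Set.image_vadd, show (fun x : A => y₀ +ᵥ x) = fun x => y₀ + x from rfl]
    exact ((measurePreserving_add_left μA y₀).setIntegral_image_emb (MeasurableEquiv.addLeft y₀).measurableEmbedding h _).symm
  rw [h1, map_eq_inv_smul_restrict_of_isOpen_range μS μA ℓ hℓc hℓ hL, integral_smul_measure, h2, ENNReal.toReal_inv]
  rfl

end Summit.HodgeConjecture.HodgeConjecture.Cruxes.H413.K2E3HaarPushforwardCoset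

end
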